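import Summits.ResolutionOfSingularities.ResolutionOfSingularities.Theorems.RadicialJungCleanModelsGiraudOverFieldDefs
import Summits.ResolutionOfSingularities.ResolutionOfSingularities.Theorems.RadicialJungCleanModelsCriticalSetPullback
import Summits.ResolutionOfSingularities.ResolutionOfSingularities.Theorems.RadicialJungCleanModelsReadOffOffCritical
import Summits.ResolutionOfSingularities.ResolutionOfSingularities.Theorems.RadicialJungCleanModelsCriticalSetClosed
import Mathlib.Data.Multiset.DershowitzManna
import Summits.ResolutionOfSingularities.ResolutionOfSingularities.Theorems.RadicialJungCleanModelsT2StepAssembly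
import Summits.ResolutionOfSingularities.ResolutionOfSingularities.Theorems.RadicialJungCleanModelsGiraudSingularFinite
import Summits.ResolutionOfSingularities.ResolutionOfSingularities.Theorems.RadicialJungCleanModelsReadOffCritical
import Summits.ResolutionOfSingularities.ResolutionOfSingularities.Theorems.RadicialJungCleanModelsGiraudStepLemma23
import HarnessLib

/-!
# Route `RadicialJung`, crux `CleanModels` (stmt-15917): **Giraud's Thm. 2.4 over an arbitrary
# field** — `Giraud24OverField` from F-75c (T2 final assembly, PROGRAMME-clean-dim2 / W8.1)

Line `via-clean-models` of crux `DescentPerfectToAll` (stmt-0549); the dimension-2 slice of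
`stub_cleanModels` (crux stmt-15917). OURS; AI-written, weaker than expert review; nothing here is a
statement of Hironaka's manuscript. This file is res-L0-w81-pv-2 g5's T2 SKELETON (architecture
`HOME/L/res-L0-w81-pv-2/g5/T2-ARCHITECTURE.md`; the composition `phaseA` → `phaseB` (well-founded
induction on the Dershowitz–Manna order of the multiset of entries `2·c(ξ) + δ(ξ)` over the
Giraud-singular points) → `readOff` is pv-2's and is reproduced verbatim) with EVERY stub replaced
by the tree theorem that discharges it:

* Phase A (B8 + B2): `phaseA_overField` (res-L0-w81-pv-2, `…CriticalSetPullback.lean`, on F-75c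
  `Stacks0BIC_embeddedResolutionCurvesInSurfaces_locus` — the ONLY hypothesis of the final theorem)
  with `E(f)` closed / nowhere dense (res-L1-s13-pv-1, `…CriticalSetClosed.lean`);
* finiteness of the Giraud-singular set (B3): `finite_isGiraudSingularPoint` (res-L0-w81-pv-2 +
  pool, `…GiraudSingularFinite.lean`);
* the step (B4/B5/B6 = Giraud's Lemme 2.3 + the measure): `exists_step_lemma23`
  (res-L0-w81-pv-1, `…GiraudStepLemma23.lean`, on res-D-pv-030's `T2.exists_step_of_trichotomy`,
  `…T2StepAssembly/StepOfLemma23/MeasureDecrease/GiraudInvariantsTransport/PointBlowupSNC/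
  BlowupStalkChart*/CriticalPrimesStalk/SncPointRsop.lean`);
* the read-off (B7): off `E(f)` `giraud15NormalFormAt_of_not_mem_derivCriticalSet`
  (res-L0-w81-pv-2, `…ReadOffOffCritical.lean`), on `E(f)` `giraud15NormalFormAt_readOff_critical`
  (res-rescue-typ-5, `…ReadOffCritical.lean`, with the `p`-basis of res-L0-w81-pv-2's
  `exists_isPBasisOver_stalk` — no Kimura–Niitsuma named fact);
* plumbing: `adm_of_isPointBlowupComposition`, `exists_isIso_off_finite_of_isPointBlowupComposition`
  (res-L0-w81-pv-2, `…T2Plumbing.lean`).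

**Main theorem**: `giraud24OverField_of_f75c : Stacks0BIC_embeddedResolutionCurvesInSurfaces_locus →
Giraud24OverField`. Consumer: `cleanModels_dimTwo_of_giraud24OverField`
(`…DimTwoCleanOverField.lean`) ⇒ `CleanModels` for `dim W = 2` over EVERY field, modulo F-75c
(Stacks 0BIC, embedded resolution of curves in surfaces — a published theorem typed as a named
fact).

## References
* J. Giraud, Forme normale d'une fonction sur une surface de caractéristique positive,
  Bull. SMF 111 (1983), Lemme 2.3, Thm. 2.4, Prop. 1.5. [Giraud1983]
* The Stacks Project, Tag 0BIC. [StacksProject]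
* N. Dershowitz, Z. Manna, Proving termination with multiset orderings, CACM 22 (1979).
-/

noncomputable section

set_option linter.dupNamespace false -- mandated namespace of this single-conjunct summit

open CategoryTheory AlgebraicGeometry TopologicalSpace IsLocalRing
open Literature.AlgebraicGeometry.Resolution

namespace Summit.ResolutionOfSingularities.ResolutionOfSingularities.Theorems.RadicialJung.CleanModels.T2

/-! ## Two rewriting helpers -/

/-- Pull-back of a global section along a composite. -/
theorem appTop_comp_apply' {X X₁ X' : Scheme.{0}} (π' : X' ⟶ X₁) (π₁ : X₁ ⟶ X) (f : Γ(X, ⊤)) :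
    (π' ≫ π₁).appTop f = π'.appTop (π₁.appTop f) := by
  rw [Scheme.Hom.comp_appTop]; rfl

/-- Preimage along a composite. -/
theorem preimage_comp_base {X X₁ X' : Scheme.{0}} (π' : X' ⟶ X₁) (π₁ : X₁ ⟶ X) (S : Set X) :
    (π' ≫ π₁).base ⁻¹' S = π'.base ⁻¹' (π₁.base ⁻¹' S) := by
  ext x
  simp only [Set.mem_preimage, Scheme.Hom.comp_apply]

/-! ## The stubs (bricks of the architecture) -/

/-- (B3, PROVED: res-L0-w81-pv-2's `finite_isGiraudSingularPoint`,
`Theorems/RadicialJungCleanModelsGiraudSingularFinite.lean`): on an admissible stage with `E(f)` a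
strict normal crossings divisor, the Giraud-singular points form a finite set.
[cite: Giraud1983, 2.2 (3)] -/
theorem finite_singular (p : ℕ) [Fact p.Prime] (k : Type) [Field k] [CharP k p]
    (X : Scheme.{0}) [IsIntegral X] [CompactSpace X] (q : X ⟶ Spec (.of k))
    [LocallyOfFiniteType q] (hreg : Scheme.IsRegular X) (hdim : topologicalKrullDim X = 2)
    (f : Γ(X, ⊤)) (_hf : ∀ c : X.functionField, c ^ p ≠ X.presheaf.germ ⊤ (genericPoint X) trivial f)
    (hsnc : IsStrictNormalCrossingsDivisor X (derivCriticalSet X f)) :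
    {ξ : X | IsGiraudSingularPoint X f ξ}.Finite :=
  finite_isGiraudSingularPoint p k X q hreg hdim f hsnc

/-- **The step (B2 + B4/B5 + B6 — PROVED: res-L0-w81-pv-1's `exists_step_lemma23`,
`Theorems/RadicialJungCleanModelsGiraudStepLemma23.lean`, Giraud's Lemme 2.3 at the stalks over the
centre fed into res-D-pv-030's `T2.exists_step_of_trichotomy`)**: blowing up ONE Giraud-singular
point `ξ` of an admissible stage with `E(f)` snc gives a stage `X₁` (one point blowing up over
`E(f)`) with `E(f₁) = π⁻¹ E(f)` again snc and a STRICTLY SMALLER multiset of entries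
`2·c + δ` in the Dershowitz–Manna order. [cite: Giraud1983, Lemme 2.3 and Thm. 2.4] -/
theorem step (p : ℕ) [Fact p.Prime] (k : Type) [Field k] [CharP k p]
    (X : Scheme.{0}) [IsIntegral X] [CompactSpace X] (q : X ⟶ Spec (.of k))
    [LocallyOfFiniteType q] (hreg : Scheme.IsRegular X) (hdim : topologicalKrullDim X = 2)
    (f : Γ(X, ⊤)) (hf : ∀ c : X.functionField, c ^ p ≠ X.presheaf.germ ⊤ (genericPoint X) trivial f)
    (hsnc : IsStrictNormalCrossingsDivisor X (derivCriticalSet X f))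
    (ξ : X) (hξ : IsGiraudSingularPoint X f ξ) :
    ∃ (X₁ : Scheme.{0}) (π : X₁ ⟶ X), IsPointBlowupComposition (derivCriticalSet X f) π ∧
      derivCriticalSet X₁ (π.appTop f) = π.base ⁻¹' derivCriticalSet X f ∧
      IsStrictNormalCrossingsDivisor X₁ (derivCriticalSet X₁ (π.appTop f)) ∧
      ∀ (h : {ξ : X | IsGiraudSingularPoint X f ξ}.Finite)
        (h₁ : {ξ₁ : X₁ | IsGiraudSingularPoint X₁ (π.appTop f) ξ₁}.Finite),
        Multiset.IsDershowitzMannaLT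
          (h₁.toFinset.val.map fun x =>
          2 * (giraudColength (X₁.presheaf.stalk x) (X₁.presheaf.germ ⊤ x trivial (π.appTop f))).toNat +
            if (derivCriticalPrimes (X₁.presheaf.stalk x)
                (X₁.presheaf.germ ⊤ x trivial (π.appTop f))).ncard = 1 then 1 else 0)
          (h.toFinset.val.map fun x =>
          2 * (giraudColength (X.presheaf.stalk x) (X.presheaf.germ ⊤ x trivial f)).toNat +
            if (derivCriticalPrimes (X.presheaf.stalk x)
                (X.presheaf.germ ⊤ x trivial f)).ncard = 1 then 1 else 0) :=
  exists_step_lemma23 p k X q hreg hdim f hf hsnc ξ hξ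

/-- **Read-off at closed points** (B7): off `E(f)` by `giraud15NormalFormAt_of_not_mem_derivCriticalSet`
(res-L0-w81-pv-2, p562256), on `E(f)` by `giraud15NormalFormAt_readOff_critical` (res-rescue-typ-5,
p574173). [cite: Giraud1983, Prop. 1.5] -/
theorem readOff (p : ℕ) [Fact p.Prime] (k : Type) [Field k] [CharP k p]
    (X : Scheme.{0}) [IsIntegral X] (q : X ⟶ Spec (.of k)) [LocallyOfFiniteType q]
    (hreg : Scheme.IsRegular X) (hdim : topologicalKrullDim X = 2) (f : Γ(X, ⊤))
    (hf : ∀ c : X.functionField, c ^ p ≠ X.presheaf.germ ⊤ (genericPoint X) trivial f)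
    (ξ : X) (hξ : IsClosed ({ξ} : Set X))
    (h : ξ ∉ derivCriticalSet X f ∨
      (IsStrictNormalCrossingsAt X (derivCriticalSet X f) ξ ∧
        giraudColength (X.presheaf.stalk ξ) (X.presheaf.germ ⊤ ξ trivial f) = 0)) :
    Giraud15NormalFormAt p (X.presheaf.germ ⊤ ξ trivial f) := by
  rcases h with h | ⟨hsnc, hc⟩
  · exact giraud15NormalFormAt_of_not_mem_derivCriticalSet (Fact.out : p.Prime).ne_zero X hreg f h
  · by_cases hξE : ξ ∈ derivCriticalSet X f
    · exact giraud15NormalFormAt_readOff_critical p k X q hreg hdim f hf ξ hξ hξE hsnc hc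
    · exact giraud15NormalFormAt_of_not_mem_derivCriticalSet (Fact.out : p.Prime).ne_zero X hreg f hξE

/-- **Phase A** (B8): `phaseA_overField` (PROVED: F-75c on the reduced subscheme `E(f)`, then
`E(f₁) = π⁻¹E(f)` by B2) with `E(f)` closed / nowhere dense (PROVED, res-L1-s13-pv-1's
`RadicialJungCleanModelsCriticalSetClosed.lean`).
[cite: StacksProject, Tag 0BIC] [cite: Giraud1983, Thm. 2.4 (proof)] -/
theorem phaseA (h75c : Stacks0BIC_embeddedResolutionCurvesInSurfaces_locus.{0})
    (p : ℕ) [Fact p.Prime] (k : Type) [Field k] [CharP k p]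
    (X : Scheme.{0}) [IsIntegral X] [CompactSpace X] (q : X ⟶ Spec (.of k))
    [LocallyOfFiniteType q] (hreg : Scheme.IsRegular X) (hdim : topologicalKrullDim X = 2)
    (f : Γ(X, ⊤)) (hf : ∀ c : X.functionField, c ^ p ≠ X.presheaf.germ ⊤ (genericPoint X) trivial f) :
    ∃ (X₁ : Scheme.{0}) (π : X₁ ⟶ X), IsPointBlowupComposition (derivCriticalSet X f) π ∧
      derivCriticalSet X₁ (π.appTop f) = π.base ⁻¹' derivCriticalSet X f ∧
      IsStrictNormalCrossingsDivisor X₁ (derivCriticalSet X₁ (π.appTop f)) :=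
  phaseA_overField p k h75c X q hreg hdim f (isClosed_derivCriticalSet p q hreg f)
    (isNowhereDense_derivCriticalSet p q hreg f hf)

/-! ## The loop (Phase B): proved from the stubs -/

/-- **Phase B.** From an admissible stage with `E(f)` snc, finitely many blow-ups of Giraud-singular
points reach a stage with NO Giraud-singular point (well-founded induction on the Dershowitz–Manna
order of the measure). [cite: Giraud1983, Thm. 2.4] -/
theorem phaseB (p : ℕ) [Fact p.Prime] (k : Type) [Field k] [CharP k p] :
    ∀ (M : Multiset ℕ) (X : Scheme.{0}) [IsIntegral X] [CompactSpace X] (q : X ⟶ Spec (.of k))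
      [LocallyOfFiniteType q], Scheme.IsRegular X → topologicalKrullDim X = 2 →
      ∀ (f : Γ(X, ⊤)),
      (∀ c : X.functionField, c ^ p ≠ X.presheaf.germ ⊤ (genericPoint X) trivial f) →
      IsStrictNormalCrossingsDivisor X (derivCriticalSet X f) →
      (∀ h : {ξ : X | IsGiraudSingularPoint X f ξ}.Finite,
        (h.toFinset.val.map fun x =>
          2 * (giraudColength (X.presheaf.stalk x) (X.presheaf.germ ⊤ x trivial f)).toNat +
            if (derivCriticalPrimes (X.presheaf.stalk x)
                (X.presheaf.germ ⊤ x trivial f)).ncard = 1 then 1 else 0) = M) →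
      ∃ (X' : Scheme.{0}) (π : X' ⟶ X), IsPointBlowupComposition (derivCriticalSet X f) π ∧
        derivCriticalSet X' (π.appTop f) = π.base ⁻¹' derivCriticalSet X f ∧
        IsStrictNormalCrossingsDivisor X' (derivCriticalSet X' (π.appTop f)) ∧
        ∀ ξ' : X', ¬ IsGiraudSingularPoint X' (π.appTop f) ξ' := by
  intro M
  induction M using (Multiset.wellFounded_isDershowitzMannaLT (α := ℕ)).induction with
  | _ M ih =>
  intro X _ _ q _ hreg hdim f hf hsnc hM
  by_cases hsing : ∃ ξ : X, IsGiraudSingularPoint X f ξ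
  · obtain ⟨ξ, hξ⟩ := hsing
    obtain ⟨X₁, π₁, hπ₁, hE₁, hsnc₁, hlt⟩ := step p k X q hreg hdim f hf hsnc ξ hξ
    obtain ⟨hX₁int, hX₁cpt, hX₁lft, hX₁reg, hX₁dim, hf₁⟩ :=
      adm_of_isPointBlowupComposition p k q hreg hdim f hf hπ₁
    have hfin := finite_singular p k X q hreg hdim f hf hsnc
    have hfin₁ := finite_singular p k X₁ (π₁ ≫ q) hX₁reg hX₁dim (π₁.appTop f) hf₁ hsnc₁
    have hlt' : Multiset.IsDershowitzMannaLT
        (hfin₁.toFinset.val.map fun x =>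
          2 * (giraudColength (X₁.presheaf.stalk x) (X₁.presheaf.germ ⊤ x trivial (π₁.appTop f))).toNat +
            if (derivCriticalPrimes (X₁.presheaf.stalk x)
                (X₁.presheaf.germ ⊤ x trivial (π₁.appTop f))).ncard = 1 then 1 else 0) M := by
      rw [← hM hfin]; exact hlt hfin hfin₁
    obtain ⟨X', π', hπ', hE', hsnc', hnone⟩ := ih _ hlt' X₁ (π₁ ≫ q) hX₁reg hX₁dim (π₁.appTop f)
      hf₁ hsnc₁ (fun h => by rw [Subsingleton.elim h hfin₁])
    refine ⟨X', π' ≫ π₁, ?_, ?_, ?_, ?_⟩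
    · exact hπ₁.comp (T₁ := derivCriticalSet X₁ (π₁.appTop f))
        (by rw [hE₁]; exact Set.image_preimage_subset _ _) hπ'
    · rw [appTop_comp_apply', hE', hE₁, preimage_comp_base]
    · rw [appTop_comp_apply']; exact hsnc'
    · rw [appTop_comp_apply']; exact hnone
  · push Not at hsing
    have h1 : (𝟙 X : X ⟶ X).appTop f = f := by simp
    refine ⟨X, 𝟙 X, IsPointBlowupComposition.nil, ?_, ?_, fun ξ => ?_⟩
    · rw [h1]; ext x; simp
    · rw [h1]; exact hsnc
    · rw [h1]; exact hsing ξ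

/-! ## The composition -/

/-- **Giraud's Thm. 2.4 with Prop. 1.5 (ii) for regular surfaces over an ARBITRARY field**
(`Giraud24OverField`), from the embedded resolution of curves in surfaces (F-75c, Stacks 0BIC).
Everything else — Phase A, finiteness of the Giraud-singular set, the Dershowitz–Manna loop on
Giraud's Lemme 2.3, the read-off Prop. 1.5 with a Kimura–Niitsuma-free `p`-basis — is proved in
the tree. [cite: Giraud1983, Thm. 2.4] [cite: StacksProject, Tag 0BIC] -/
theorem giraud24OverField_of_f75c (h75c : Stacks0BIC_embeddedResolutionCurvesInSurfaces_locus.{0}) :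
    Giraud24OverField := by
  intro p _ k _ _ X _ _ q _ hreg hdim f hf
  -- Phase A
  obtain ⟨X₁, π₁, hπ₁, hE₁, hsnc₁⟩ := phaseA h75c p k X q hreg hdim f hf
  obtain ⟨hX₁int, hX₁cpt, hX₁lft, hX₁reg, hX₁dim, hf₁⟩ :=
    adm_of_isPointBlowupComposition p k q hreg hdim f hf hπ₁
  -- Phase B
  have hfin₁ := finite_singular p k X₁ (π₁ ≫ q) hX₁reg hX₁dim (π₁.appTop f) hf₁ hsnc₁
  obtain ⟨X₂, π₂, hπ₂, hE₂, hsnc₂, hnone⟩ := phaseB p k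
    (hfin₁.toFinset.val.map fun x =>
          2 * (giraudColength (X₁.presheaf.stalk x) (X₁.presheaf.germ ⊤ x trivial (π₁.appTop f))).toNat +
            if (derivCriticalPrimes (X₁.presheaf.stalk x)
                (X₁.presheaf.germ ⊤ x trivial (π₁.appTop f))).ncard = 1 then 1 else 0) X₁
    (π₁ ≫ q) hX₁reg hX₁dim (π₁.appTop f) hf₁ hsnc₁ (fun _ => rfl)
  have hπ : IsPointBlowupComposition (derivCriticalSet X f) (π₂ ≫ π₁) :=
    hπ₁.comp (T₁ := derivCriticalSet X₁ (π₁.appTop f))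
      (by rw [hE₁]; exact Set.image_preimage_subset _ _) hπ₂
  obtain ⟨hX₂int, hX₂cpt, hX₂lft, hX₂reg, hX₂dim, hf₂⟩ :=
    adm_of_isPointBlowupComposition p k q hreg hdim f hf hπ
  haveI : IsLocallyNoetherian X := LocallyOfFiniteType.isLocallyNoetherian q
  haveI : IsNoetherian X := ⟨⟩
  obtain ⟨U, hUfin, hUcl, hUiso⟩ := exists_isIso_off_finite_of_isPointBlowupComposition hπ
  refine ⟨X₂, π₂ ≫ π₁, hπ.isProper inferInstance, hX₂int, hX₂reg, ⟨U, hUfin, hUcl, hUiso⟩,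
    fun x' hx' => ?_⟩
  -- read-off at the closed point `x'`
  rw [appTop_comp_apply']
  rw [appTop_comp_apply'] at hf₂
  refine readOff p k X₂ ((π₂ ≫ π₁) ≫ q) hX₂reg hX₂dim (π₂.appTop (π₁.appTop f)) hf₂ x' hx' ?_
  by_cases hx'E : x' ∈ derivCriticalSet X₂ (π₂.appTop (π₁.appTop f))
  · right
    refine ⟨hsnc₂.isStrictNormalCrossingsAt hx'E, ?_⟩
    by_contra hc
    exact hnone x' ⟨hx', hx'E, hsnc₂.isStrictNormalCrossingsAt hx'E, hc⟩
  · exact Or.inl hx'E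

end Summit.ResolutionOfSingularities.ResolutionOfSingularities.Theorems.RadicialJung.CleanModels.T2

end
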